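/-
Copyright (c) 2026 the pub-hodgecm-mathlib formalisation cell (harness21).  Prover seat hodgecm-mathlib-LH4-p08 (g11) (valve hand), Track B «K2-LIT»,
#184♮ = hLiu418 = `stmt-HodgeConjecture-24832`; socket #41 `sig_K2LiuSiegelEisensteinContinuation`, KIND W, (iii-arch) — LEAD F0P6-plan (g14) BATCH #142 (3)
2026-09-04T23:26:09Z «DEFINE `Finf j :=` the archimedean continuation of the arch integral of `FinfT j` + `hFinf` holomorphy on `{0 < re}`, BY VALUE on `FinfT`»;
desk K2E4-p10 (g9); boxes K2-defs1 (def tokens) + K2Liu-audit1.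
DEFINITIONS + THEOREMS (no `instance`, no notation, no named-fact hypothesis, no `sorry`).
-/
import Summits.HodgeConjecture.HodgeConjecture.Theorems.K2LiuSiegelEisensteinKindWLetters           -- ★ (x-a) ED. 1–2: `kindWFinset`, the KIND-W frame
import Summits.HodgeConjecture.HodgeConjecture.Theorems.K2LiuSiegelEisensteinWhittakerFactorLetters  -- ★ `skewMatrices`, `gramR` (frame of the TOP's KIND-W block)
import Mathlib.Analysis.Complex.CauchyIntegral
import Mathlib.Analysis.Analytic.Uniqueness
import HarnessLib

/-!
# Crux `HLiu418`, socket #41, KIND W — `K2LiuKindWArchLetterDefs` ((iii-arch)): THE CONTINUED ARCHIMEDEAN LETTER `Finf` AS A DECLARATION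

Cell `hodgecm-mathlib`, crux item hLiu418 = `stmt-HodgeConjecture-24832` (helper lane `--supports …`, count-neutral), route of record `HCCMUnconditional`;
squad K2 ∕ K2Liu, road `K2_Liu`, socket #41, KIND W.  ★ (x-a) ED. 4 `K2LiuSiegelEisensteinKindWEulerLocalLetters.exists_kindW_eulerLetters_of_localLetters` and the
KW payer head ★ `K2LiuSiegelEisensteinKindWOfRecord.kindW_block_of_record` take the CONTINUED archimedean local letters BY VALUE:
`Finf : Fin m → skew → ℂ → HA → ℂ` with `hFinf` (holomorphy of `s ↦ Finf j S s h` on `{0 < re s}`) and `hFinfI` (on `{n∕2 < re s}`, `det S ≠ 0`: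
`Finf j S s h = ∫ a, conj ψ_S(ι_∞ a) · FinfT j S h s (w_Δ,∞ · a · h_∞) ∂ν_∞` — the archimedean Whittaker INTEGRAL of the summand `FinfT j`).  For a by-value
archimedean family `FinfT` no continuation need exist, so `hFinf` and `hFinfI` cannot both be unconditional theorems of one declaration; THIS FILE makes the
honest split:
* §1 (pure complex analysis) continuations from `{a₀ < re}` to `{0 < re}` («`F` holomorphic on `{0 < re}` and `= I` on `{a₀ < re}`», an explicit conjunction), the declaration
  **`halfPlaneContinuation a₀ I`** (`:=` a chosen continuation if one exists, else `0`), `differentiableOn_halfPlaneContinuation` (UNCONDITIONAL holomorphy),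
  `halfPlaneContinuation_eq` (equals `I` on `{a₀ < re}` given existence), and CANONICITY by the identity theorem: `eqOn_of_halfPlaneContinuations` (two
  continuations agree on `{0 < re}`), `halfPlaneContinuation_eqOn` (the declaration agrees with EVERY continuation) — Mathlib `DifferentiableOn.analyticOnNhd`,
  `AnalyticOnNhd.eqOn_of_preconnected_of_eventuallyEq`, `convex_halfSpace_re_gt`;
* §2 (the KIND-W frame) **`archWhittakerIntegral ν S Φ g`** (`s ↦ ∫ a, conj ψ_S(ι_∞ a) · Φ s (w_Δ,∞ · a · g) ∂ν`, the right-hand side of `hFinfI` as a function of `s`,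
  generic archimedean family `Φ : ℂ → arch → ℂ` and point `g : arch`) and **`kindWArchLetter νinf T₀ FinfT j S s h`**
  `:= halfPlaneContinuation (n∕2) (archWhittakerIntegral (νinf (kindWFinset T₀ S h)) S (FinfT j S h) h_∞) s` — ★ ED. 4's `Finf`, with
  **`differentiableOn_kindWArchLetter`** = its `hFinf` bytes UNCONDITIONALLY and **`kindWArchLetter_eq_integral`** = its `hFinfI` bytes under the per-`(j,S,h)` EXISTENCE
  letter `∃ F, DifferentiableOn ℂ F {0 < re} ∧ ∀ s, n∕2 < re s → F s = archWhittakerIntegral … s` (the archimedean organ: ★ JUNCTION `kFiniteSection_whittaker_holomorphy_growth` pays it at a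
  definite index for `K_∞`-finite flat sections at `n = 2`; indefinite indices = Shimura 1982 §3–§4, no ★ payer yet), plus `kindWArchLetter_eqOn` (canonicity: any
  explicit continuation, e.g. Shimura's confluent hypergeometric `ω`, IS `kindWArchLetter` on `{0 < re}`, so its growth letters transfer and feed ★
  `K2LiuSiegelEisensteinKindWArchBlockIndefinite.archGrowth_le_heightDecay_of_entryLetters`).
[MoeglinWaldspurger1995, II.1.5–II.1.7, IV.1.9] [Shimura1997, §A3]; Shimura 1982 (Math. Ann. 260) §3–§4 (prose reference; no registered bib key).
HONEST LABEL.  Count-neutral helper, closes no socket: `HC_CM` is proved only modulo the 7 printed citations (2 remaining named inputs: hLiu418 =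
`stmt-HodgeConjecture-24832`, h413 = `stmt-HodgeConjecture-24833`) until rung 0 closes.
-/

set_option autoImplicit false
-- the mandated namespace repeats the single-problem summit's segment (`HodgeConjecture.HodgeConjecture`)
set_option linter.dupNamespace false

noncomputable section

open scoped Matrix RestrictedProduct ENNReal NNReal Topology ComplexConjugate BigOperators
open NumberField IsDedekindDomain MeasureTheory Measure Filter Set

namespace Summit.HodgeConjecture.HodgeConjecture.Cruxes.HLiu418.K2LiuKindWArchLetterDefs

/-! ## §1 Half-plane continuations (pure complex analysis) -/

section HalfPlane

/-
A CONTINUATION of `I : ℂ → ℂ` from the half-plane `{a₀ < re}` to `{0 < re}` is an `F : ℂ → ℂ` with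
`DifferentiableOn ℂ F {s | 0 < s.re} ∧ ∀ s, a₀ < s.re → F s = I s` (kept as an explicit conjunction, not a named predicate).
-/

open Classical in
/-- **THE CONTINUATION OF `I` TO `{0 < re}` AS A DECLARATION**: an `F` holomorphic on `{0 < re s}` with `F = I` on `{a₀ < re s}` if one exists (chosen once; canonical
on `{0 < re}` by `halfPlaneContinuation_eqOn`), and `0` otherwise. [cite: MoeglinWaldspurger1995, IV.1.9] -/
def halfPlaneContinuation (a₀ : ℝ) (I : ℂ → ℂ) : ℂ → ℂ :=
  if H : ∃ F : ℂ → ℂ, DifferentiableOn ℂ F {s : ℂ | 0 < s.re} ∧ ∀ s : ℂ, a₀ < s.re → F s = I s then H.choose else 0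

/-- the declared continuation is holomorphic on `{0 < re}` — UNCONDITIONALLY (the `0` branch is constant). [cite: MoeglinWaldspurger1995, IV.1.9] -/
theorem differentiableOn_halfPlaneContinuation (a₀ : ℝ) (I : ℂ → ℂ) : DifferentiableOn ℂ (halfPlaneContinuation a₀ I) {s : ℂ | 0 < s.re} := by
  unfold halfPlaneContinuation
  split_ifs with H
  · exact H.choose_spec.1
  · exact differentiableOn_const 0

/-- given a continuation exists, the declared one equals `I` on `{a₀ < re}`. [cite: MoeglinWaldspurger1995, IV.1.9] -/
theorem halfPlaneContinuation_eq {a₀ : ℝ} {I : ℂ → ℂ} (H : ∃ F : ℂ → ℂ, DifferentiableOn ℂ F {s : ℂ | 0 < s.re} ∧ ∀ s : ℂ, a₀ < s.re → F s = I s)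
    {s : ℂ} (hs : a₀ < s.re) : halfPlaneContinuation a₀ I s = I s := by
  unfold halfPlaneContinuation
  rw [dif_pos H]
  exact H.choose_spec.2 s hs

/-- if no continuation exists, the declaration is `0`. [folklore] -/
theorem halfPlaneContinuation_of_not_exists {a₀ : ℝ} {I : ℂ → ℂ}
    (H : ¬ ∃ F : ℂ → ℂ, DifferentiableOn ℂ F {s : ℂ | 0 < s.re} ∧ ∀ s : ℂ, a₀ < s.re → F s = I s) :
    halfPlaneContinuation a₀ I = 0 := by
  unfold halfPlaneContinuation
  rw [dif_neg H]

/-- **UNIQUENESS (identity theorem)**: two continuations of the same `I` agree on the whole right half-plane (it is preconnected and both agree with `I` on the open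
non-empty sub-half-plane `{max a₀ 0 < re}`). [cite: MoeglinWaldspurger1995, IV.1.9] -/
theorem eqOn_of_halfPlaneContinuations {a₀ : ℝ} {I F G : ℂ → ℂ} (hF : DifferentiableOn ℂ F {s : ℂ | 0 < s.re} ∧ ∀ s : ℂ, a₀ < s.re → F s = I s)
    (hG : DifferentiableOn ℂ G {s : ℂ | 0 < s.re} ∧ ∀ s : ℂ, a₀ < s.re → G s = I s) :
    Set.EqOn F G {s : ℂ | 0 < s.re} := by
  have hU : IsOpen {s : ℂ | 0 < s.re} := isOpen_lt continuous_const Complex.continuous_re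
  have hUc : IsPreconnected {s : ℂ | 0 < s.re} := (convex_halfSpace_re_gt 0).isPreconnected
  have hV : IsOpen {s : ℂ | a₀ < s.re} := isOpen_lt continuous_const Complex.continuous_re
  set z₀ : ℂ := ((max a₀ 0 + 1 : ℝ) : ℂ) with hz₀
  have hre : z₀.re = max a₀ 0 + 1 := by rw [hz₀, Complex.ofReal_re]
  have hz₀U : z₀ ∈ {s : ℂ | 0 < s.re} := by
    show 0 < z₀.re
    rw [hre]
    exact lt_of_le_of_lt (le_max_right a₀ 0) (lt_add_one _)
  have hz₀V : z₀ ∈ {s : ℂ | a₀ < s.re} := by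
    show a₀ < z₀.re
    rw [hre]
    exact lt_of_le_of_lt (le_max_left a₀ 0) (lt_add_one _)
  have hev : F =ᶠ[𝓝 z₀] G := by
    filter_upwards [hV.mem_nhds hz₀V] with s hs
    rw [hF.2 s hs, hG.2 s hs]
  exact (hF.1.analyticOnNhd hU).eqOn_of_preconnected_of_eventuallyEq (hG.1.analyticOnNhd hU) hUc hz₀U hev

/-- **CANONICITY**: the declared continuation agrees on `{0 < re}` with EVERY continuation of `I`. [cite: MoeglinWaldspurger1995, IV.1.9] -/
theorem halfPlaneContinuation_eqOn {a₀ : ℝ} {I F : ℂ → ℂ} (hF : DifferentiableOn ℂ F {s : ℂ | 0 < s.re} ∧ ∀ s : ℂ, a₀ < s.re → F s = I s) :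
    Set.EqOn (halfPlaneContinuation a₀ I) F {s : ℂ | 0 < s.re} := by
  have H : ∃ G : ℂ → ℂ, DifferentiableOn ℂ G {s : ℂ | 0 < s.re} ∧ ∀ s : ℂ, a₀ < s.re → G s = I s := ⟨F, hF⟩
  have hspec : DifferentiableOn ℂ (halfPlaneContinuation a₀ I) {s : ℂ | 0 < s.re} ∧ ∀ s : ℂ, a₀ < s.re → halfPlaneContinuation a₀ I s = I s := by
    unfold halfPlaneContinuation
    rw [dif_pos H]
    exact H.choose_spec
  exact eqOn_of_halfPlaneContinuations hspec hF

end HalfPlane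

/-! ## §2 The archimedean Whittaker integral and the continued KIND-W archimedean letter -/

section Arch

open Literature.NumberTheory.Automorphic Literature.NumberTheory.GaloisRepresentations Literature.NumberTheory.LFunctions
open Literature.NumberTheory.GelbartRogawski1991 Literature.NumberTheory.GelbartRogawski1991.GRConstruction
open Literature.NumberTheory.K2Lit.SiegelDoubled
open Literature.NumberTheory.K2Lit.PlaceSplitting
open Literature.MeasureTheory.RestrictedProduct
open Literature.Topology.Algebra.RestrictedProduct (inH)
open Summit.HodgeConjecture.HodgeConjecture.Cruxes.HLiu418.K2LiuSiegelUnipotentLocalDefs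
open Summit.HodgeConjecture.HodgeConjecture.Cruxes.HLiu418.K2LiuSiegelUnipotentSplitDefs
open Summit.HodgeConjecture.HodgeConjecture.Cruxes.HLiu418.K2LiuSiegelUnipotentSplitAtDefs
open Summit.HodgeConjecture.HodgeConjecture.Cruxes.HLiu418.K2LiuSiegelUnipotentHaarPinned
open Summit.HodgeConjecture.HodgeConjecture.Cruxes.HLiu418.K2LiuSiegelUnipotentEulerProduct
open Summit.HodgeConjecture.HodgeConjecture.Cruxes.HLiu418.K2LiuSiegelUnipotentFourierDefs
open Summit.HodgeConjecture.HodgeConjecture.Cruxes.HLiu418.K2LiuWhittakerDeltaEulerHead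
open Summit.HodgeConjecture.HodgeConjecture.Cruxes.HLiu418.K2LiuWhittakerDeltaEulerProduct
open Summit.HodgeConjecture.HodgeConjecture.Cruxes.HLiu418.K2LiuSiegelEisensteinKindWLetters

variable (L : Type) [Field L] [NumberField L] [IsCMField L]
variable {N M n : ℕ} (e : Fin N × Fin M ≃ Fin n)
  (dV : Fin N → L) (hdV : ∀ i, IsCMField.complexConj L (dV i) = dV i)
  (dW : Fin M → L) (hdW : ∀ i, IsCMField.complexConj L (dW i) = dW i)
  [MeasurableSpace ↥(unipDeltaArch L e dV hdV dW hdW)]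

/-- **THE ARCHIMEDEAN WHITTAKER INTEGRAL** of an archimedean family `Φ : ℂ → H(L⊗ℝ) → ℂ` at the index `S` and the archimedean point `g`, as a function of `s`:
`s ↦ ∫ a, conj ψ_S(ι_∞ a) · Φ s (w_Δ,∞ · a · g) ∂ν` over `N_Δ(L⁺⊗ℝ)` — the right-hand side of ★ ED. 4's `hFinfI` with `Φ := FinfT j S h`, `g := h_∞`,
`ν := ν_∞(kindWFinset T₀ S h)`. [cite: MoeglinWaldspurger1995, II.1.5] [cite: Shimura1997, §A3] -/
def archWhittakerIntegral (ν : Measure ↥(unipDeltaArch L e dV hdV dW hdW)) (S : Matrix (Fin n) (Fin n) L)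
    (Φ : ℂ → UnitaryGroup.arch (Fp L) L (IsCMField.complexConj L) (n + n) (hermD L e dV hdV dW hdW) → ℂ)
    (g : UnitaryGroup.arch (Fp L) L (IsCMField.complexConj L) (n + n) (hermD L e dV hdV dW hdW)) (s : ℂ) : ℂ :=
  ∫ a, conj (unipDeltaChar L e dV hdV dW hdW S
        (UnitaryGroup.archToAdelic (Fp L) L (IsCMField.complexConj L) (n + n) (hermD L e dV hdV dW hdW)
          (a : UnitaryGroup.arch (Fp L) L (IsCMField.complexConj L) (n + n) (hermD L e dV hdV dW hdW))) : ℂ) *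
      Φ s (UnitaryGroup.archPart (Fp L) L (IsCMField.complexConj L) (n + n) (hermD L e dV hdV dW hdW) (weylDelta L e dV hdV dW hdW) *
          (a : UnitaryGroup.arch (Fp L) L (IsCMField.complexConj L) (n + n) (hermD L e dV hdV dW hdW)) * g) ∂ν

/-- **THE CONTINUED ARCHIMEDEAN KIND-W LETTER `Finf`** (★ ED. 4's by-value `Finf`, now a declaration): for the Σ⊗ summands `FinfT j` of the `T`-part at
`T(S,h) = kindWFinset T₀ S h`, `Finf j S s h := halfPlaneContinuation (n∕2) (archWhittakerIntegral (ν_∞(T(S,h))) S (FinfT j S h) h_∞) s` — the continuation to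
`{0 < re s}` of the archimedean Whittaker integral of `FinfT j S h`, canonical by the identity theorem. [cite: MoeglinWaldspurger1995, II.1.7, IV.1.9] -/
def kindWArchLetter (νinf : Finset (HeightOneSpectrum (𝓞 (Fp L))) → Measure ↥(unipDeltaArch L e dV hdV dW hdW))
    (T₀ : Finset (HeightOneSpectrum (𝓞 (Fp L)))) {m : ℕ}
    (FinfT : Fin m → skewMatrices ((IsCMField.complexConj L : L ≃ₐ[Fp L] L) : L →+* L) ((gramR L e dV hdV dW hdW).map (algebraMap (Fp L) L)) →
      HA L e dV hdV dW hdW → ℂ → UnitaryGroup.arch (Fp L) L (IsCMField.complexConj L) (n + n) (hermD L e dV hdV dW hdW) → ℂ)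
    (j : Fin m) (S : skewMatrices ((IsCMField.complexConj L : L ≃ₐ[Fp L] L) : L →+* L) ((gramR L e dV hdV dW hdW).map (algebraMap (Fp L) L)))
    (s : ℂ) (h : HA L e dV hdV dW hdW) : ℂ :=
  halfPlaneContinuation ((n : ℝ) / 2)
    (archWhittakerIntegral L e dV hdV dW hdW (νinf (kindWFinset L e dV hdV dW hdW T₀ (S : Matrix (Fin n) (Fin n) L) h)) (S : Matrix (Fin n) (Fin n) L)
      (FinfT j S h) (UnitaryGroup.archPart (Fp L) L (IsCMField.complexConj L) (n + n) (hermD L e dV hdV dW hdW) h)) s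

/-- **`hFinf` OF ★ ED. 4, UNCONDITIONALLY**: `s ↦ Finf j S s h` is holomorphic on `{0 < re s}` for every `j S h`. [cite: MoeglinWaldspurger1995, IV.1.9] -/
theorem differentiableOn_kindWArchLetter (νinf : Finset (HeightOneSpectrum (𝓞 (Fp L))) → Measure ↥(unipDeltaArch L e dV hdV dW hdW))
    (T₀ : Finset (HeightOneSpectrum (𝓞 (Fp L)))) {m : ℕ}
    (FinfT : Fin m → skewMatrices ((IsCMField.complexConj L : L ≃ₐ[Fp L] L) : L →+* L) ((gramR L e dV hdV dW hdW).map (algebraMap (Fp L) L)) →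
      HA L e dV hdV dW hdW → ℂ → UnitaryGroup.arch (Fp L) L (IsCMField.complexConj L) (n + n) (hermD L e dV hdV dW hdW) → ℂ) :
    ∀ (j : Fin m) (S : skewMatrices ((IsCMField.complexConj L : L ≃ₐ[Fp L] L) : L →+* L) ((gramR L e dV hdV dW hdW).map (algebraMap (Fp L) L)))
      (h : HA L e dV hdV dW hdW), DifferentiableOn ℂ (fun s => kindWArchLetter L e dV hdV dW hdW νinf T₀ FinfT j S s h) {s : ℂ | 0 < s.re} :=
  fun _ _ _ => differentiableOn_halfPlaneContinuation _ _

/-- **`hFinfI` OF ★ ED. 4, UNDER THE PER-`(j,S,h)` EXISTENCE LETTER** (the archimedean continuation organ, BY VALUE): if for every `j S h` with `det S ≠ 0` the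
archimedean Whittaker integral of `FinfT j S h` at `h_∞` admits a continuation to `{0 < re}` from `{n∕2 < re}`, then on `{n∕2 < re s}` the declared letter IS that
integral. [cite: MoeglinWaldspurger1995, II.1.5, IV.1.9] -/
theorem kindWArchLetter_eq_integral (νinf : Finset (HeightOneSpectrum (𝓞 (Fp L))) → Measure ↥(unipDeltaArch L e dV hdV dW hdW))
    (T₀ : Finset (HeightOneSpectrum (𝓞 (Fp L)))) {m : ℕ}
    (FinfT : Fin m → skewMatrices ((IsCMField.complexConj L : L ≃ₐ[Fp L] L) : L →+* L) ((gramR L e dV hdV dW hdW).map (algebraMap (Fp L) L)) →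
      HA L e dV hdV dW hdW → ℂ → UnitaryGroup.arch (Fp L) L (IsCMField.complexConj L) (n + n) (hermD L e dV hdV dW hdW) → ℂ)
    (hex : ∀ (j : Fin m) (S : skewMatrices ((IsCMField.complexConj L : L ≃ₐ[Fp L] L) : L →+* L) ((gramR L e dV hdV dW hdW).map (algebraMap (Fp L) L)))
      (h : HA L e dV hdV dW hdW), (S : Matrix (Fin n) (Fin n) L).det ≠ 0 →
      ∃ F : ℂ → ℂ, DifferentiableOn ℂ F {s : ℂ | 0 < s.re} ∧ ∀ s : ℂ, (n : ℝ) / 2 < s.re → F s =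
        archWhittakerIntegral L e dV hdV dW hdW (νinf (kindWFinset L e dV hdV dW hdW T₀ (S : Matrix (Fin n) (Fin n) L) h)) (S : Matrix (Fin n) (Fin n) L)
          (FinfT j S h) (UnitaryGroup.archPart (Fp L) L (IsCMField.complexConj L) (n + n) (hermD L e dV hdV dW hdW) h) s) :
    ∀ (j : Fin m) (S : skewMatrices ((IsCMField.complexConj L : L ≃ₐ[Fp L] L) : L →+* L) ((gramR L e dV hdV dW hdW).map (algebraMap (Fp L) L)))
      (h : HA L e dV hdV dW hdW) (s : ℂ), (n : ℝ) / 2 < s.re → (S : Matrix (Fin n) (Fin n) L).det ≠ 0 →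
      kindWArchLetter L e dV hdV dW hdW νinf T₀ FinfT j S s h = ∫ a, conj (unipDeltaChar L e dV hdV dW hdW (S : Matrix (Fin n) (Fin n) L)
            (UnitaryGroup.archToAdelic (Fp L) L (IsCMField.complexConj L) (n + n) (hermD L e dV hdV dW hdW)
              (a : UnitaryGroup.arch (Fp L) L (IsCMField.complexConj L) (n + n) (hermD L e dV hdV dW hdW))) : ℂ) *
          FinfT j S h s (UnitaryGroup.archPart (Fp L) L (IsCMField.complexConj L) (n + n) (hermD L e dV hdV dW hdW) (weylDelta L e dV hdV dW hdW) *
              (a : UnitaryGroup.arch (Fp L) L (IsCMField.complexConj L) (n + n) (hermD L e dV hdV dW hdW)) *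
              UnitaryGroup.archPart (Fp L) L (IsCMField.complexConj L) (n + n) (hermD L e dV hdV dW hdW) h) ∂(νinf (kindWFinset L e dV hdV dW hdW T₀ (S : Matrix (Fin n) (Fin n) L) h)) :=
  fun j S h _ hs hdet => halfPlaneContinuation_eq (hex j S h hdet) hs

/-- **CANONICITY AT THE KIND-W INSTANTIATION**: any continuation `F` of the archimedean Whittaker integral of `FinfT j S h` (e.g. an explicit confluent hypergeometric one)
IS the declared letter on `{0 < re}` — so growth letters proved for `F` hold for `Finf`. [cite: MoeglinWaldspurger1995, IV.1.9] -/
theorem kindWArchLetter_eqOn (νinf : Finset (HeightOneSpectrum (𝓞 (Fp L))) → Measure ↥(unipDeltaArch L e dV hdV dW hdW))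
    (T₀ : Finset (HeightOneSpectrum (𝓞 (Fp L)))) {m : ℕ}
    (FinfT : Fin m → skewMatrices ((IsCMField.complexConj L : L ≃ₐ[Fp L] L) : L →+* L) ((gramR L e dV hdV dW hdW).map (algebraMap (Fp L) L)) →
      HA L e dV hdV dW hdW → ℂ → UnitaryGroup.arch (Fp L) L (IsCMField.complexConj L) (n + n) (hermD L e dV hdV dW hdW) → ℂ)
    (j : Fin m) (S : skewMatrices ((IsCMField.complexConj L : L ≃ₐ[Fp L] L) : L →+* L) ((gramR L e dV hdV dW hdW).map (algebraMap (Fp L) L)))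
    (h : HA L e dV hdV dW hdW) {F : ℂ → ℂ}
    (hF : DifferentiableOn ℂ F {s : ℂ | 0 < s.re} ∧ ∀ s : ℂ, (n : ℝ) / 2 < s.re → F s =
      archWhittakerIntegral L e dV hdV dW hdW (νinf (kindWFinset L e dV hdV dW hdW T₀ (S : Matrix (Fin n) (Fin n) L) h)) (S : Matrix (Fin n) (Fin n) L)
        (FinfT j S h) (UnitaryGroup.archPart (Fp L) L (IsCMField.complexConj L) (n + n) (hermD L e dV hdV dW hdW) h) s) :
    Set.EqOn (fun s => kindWArchLetter L e dV hdV dW hdW νinf T₀ FinfT j S s h) F {s : ℂ | 0 < s.re} :=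
  halfPlaneContinuation_eqOn hF

end Arch

end Summit.HodgeConjecture.HodgeConjecture.Cruxes.HLiu418.K2LiuKindWArchLetterDefs

end
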